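import Summits.MatrixMultiplication.OmegaCensus.DicyclicNoCubeLaw
import Summits.MatrixMultiplication.OmegaCensus.DominoStructureTPP
import HarnessLib

/-!
# The symmetric three-set reduced form of a cube law triple (odd-order `A`)

ω-census `pub-omega`, family (b3), seat pub-omega-group gen 7.  Framing: lottery ticket; floor = certified bounds/negative
ranges.  VALUE: the kernel form of step R6.1 of the cell's three-set Radon certificates (`THEORY-radon-g7.md`); NOT
progress on ω.

**Theorem (`cube_symmetric_form_of_law`).** Let `G` be dihedral-like over a finite abelian group `A` in which every
element is a double (e.g. `|A|` odd), any `c₀`.  If a TPP triple `(S,T,U)` has cube coset parts (`|S₀| = |S₁|`,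
`|T₀| = |T₁|`, `|U₀| = |U₁|`) and attains `3|S||T||U| + 8 = 8|A|`, then there are `W, X, Y ⊆ A` with
`|W| = |S₀|`, `|X| = |T₀|`, `|Y| = |U₀|` and a point `x₀` such that the three signed sumsets
`−W+X+Y`, `W−X+Y`, `W+X−Y` (images of `W × X × Y`) are each direct, pairwise disjoint, and have union `A ∖ {x₀}` — the
S₃-symmetric reduced problem `(3★)` of the three-set Radon engine.
Proof: `cube_structure_of_law_any` (`c₀ = 0`, `S₁ = κ_S − S₀`, `T₁ = κ_T − T₀`, `U₁ = κ_U − U₀`), the vertex-`000`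
packing (`S₁+T₀+U₀`, `S₀+T₁+U₀`, `S₀+T₀+U₁` direct, pairwise disjoint, total `|A| − 1`), and the translations
`W = S₀`, `X = T₀ + b`, `Y = U₀ + c` with `2b = κ_S − κ_T`, `2c = κ_S − κ_U`.
-/

namespace Summit.MatrixMultiplication.OmegaCensus

open Literature.Combinatorics.Additive Finset

section DihedralLike

variable {A : Type*} [AddCommGroup A] [DecidableEq A] [Fintype A] {G : Type} [Group G] [DecidableEq G]
  {ρ τ : A → G} {c₀ : A} {S T U : Finset G}

/-- **Symmetric three-set reduced form of a cube law triple.** [folklore] -/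
theorem cube_symmetric_form_of_law
    (hρρ : ∀ a b, ρ a * ρ b = ρ (a + b)) (hρτ : ∀ a b, ρ a * τ b = τ (b - a))
    (hτρ : ∀ a b, τ a * ρ b = τ (a + b)) (hττ : ∀ a b, τ a * τ b = ρ (c₀ + b - a))
    (hρ : Function.Injective ρ) (hτ : Function.Injective τ) (hne : ∀ a b, ρ a ≠ τ b)
    (hsurj : ∀ g, (∃ a, ρ a = g) ∨ (∃ a, τ a = g)) (hhalf : ∀ c : A, ∃ a : A, a + a = c)
    (h : TripleProductProperty S T U)
    (hS : (univ.filter fun a : A => ρ a ∈ S).card = (univ.filter fun a : A => τ a ∈ S).card)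
    (hT : (univ.filter fun a : A => ρ a ∈ T).card = (univ.filter fun a : A => τ a ∈ T).card)
    (hU : (univ.filter fun a : A => ρ a ∈ U).card = (univ.filter fun a : A => τ a ∈ U).card)
    (hV : 3 * (S.card * T.card * U.card) + 8 = 8 * Fintype.card A) :
    ∃ (W X Y : Finset A) (x₀ : A), W.card = (univ.filter fun a : A => ρ a ∈ S).card ∧
      X.card = (univ.filter fun a : A => ρ a ∈ T).card ∧ Y.card = (univ.filter fun a : A => ρ a ∈ U).card ∧
      Set.InjOn (fun p : A × A × A => -p.1 + p.2.1 + p.2.2) ↑(W ×ˢ X ×ˢ Y) ∧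
      Set.InjOn (fun p : A × A × A => p.1 - p.2.1 + p.2.2) ↑(W ×ˢ X ×ˢ Y) ∧
      Set.InjOn (fun p : A × A × A => p.1 + p.2.1 - p.2.2) ↑(W ×ˢ X ×ˢ Y) ∧
      Disjoint ((W ×ˢ X ×ˢ Y).image fun p : A × A × A => -p.1 + p.2.1 + p.2.2)
        ((W ×ˢ X ×ˢ Y).image fun p : A × A × A => p.1 - p.2.1 + p.2.2) ∧
      Disjoint ((W ×ˢ X ×ˢ Y).image fun p : A × A × A => -p.1 + p.2.1 + p.2.2)
        ((W ×ˢ X ×ˢ Y).image fun p : A × A × A => p.1 + p.2.1 - p.2.2) ∧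
      Disjoint ((W ×ˢ X ×ˢ Y).image fun p : A × A × A => p.1 - p.2.1 + p.2.2)
        ((W ×ˢ X ×ˢ Y).image fun p : A × A × A => p.1 + p.2.1 - p.2.2) ∧
      ((W ×ˢ X ×ˢ Y).image fun p : A × A × A => -p.1 + p.2.1 + p.2.2) ∪
        ((W ×ˢ X ×ˢ Y).image fun p : A × A × A => p.1 - p.2.1 + p.2.2) ∪
        ((W ×ˢ X ×ˢ Y).image fun p : A × A × A => p.1 + p.2.1 - p.2.2) = univ.erase x₀ := by
  set S₀ : Finset A := univ.filter fun a => ρ a ∈ S with hS₀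
  set S₁ : Finset A := univ.filter fun a => τ a ∈ S with hS₁
  set T₀ : Finset A := univ.filter fun a => ρ a ∈ T with hT₀
  set T₁ : Finset A := univ.filter fun a => τ a ∈ T with hT₁
  set U₀ : Finset A := univ.filter fun a => ρ a ∈ U with hU₀
  set U₁ : Finset A := univ.filter fun a => τ a ∈ U with hU₁
  obtain ⟨-, κS, κT, κU, hκS, hκT, hκU⟩ :=
    cube_structure_of_law_any hρρ hρτ hτρ hττ hρ hτ hne hsurj h hS hT hU hV
  have mS₀ : ∀ a ∈ S₀, ρ a ∈ S := fun a ha => by simpa [hS₀] using ha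
  have mS₁ : ∀ a ∈ S₁, τ a ∈ S := fun a ha => by simpa [hS₁] using ha
  have mT₀ : ∀ a ∈ T₀, ρ a ∈ T := fun a ha => by simpa [hT₀] using ha
  have mT₁ : ∀ a ∈ T₁, τ a ∈ T := fun a ha => by simpa [hT₁] using ha
  have mU₀ : ∀ a ∈ U₀, ρ a ∈ U := fun a ha => by simpa [hU₀] using ha
  have mU₁ : ∀ a ∈ U₁, τ a ∈ U := fun a ha => by simpa [hU₁] using ha
  have mS₀c : ∀ a ∈ S₀, cond false (τ a) (ρ a) ∈ S := fun a ha => by simpa using mS₀ a ha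
  have mS₁c : ∀ a ∈ S₁, cond true (τ a) (ρ a) ∈ S := fun a ha => by simpa using mS₁ a ha
  have mT₀c : ∀ a ∈ T₀, cond false (τ a) (ρ a) ∈ T := fun a ha => by simpa using mT₀ a ha
  have mT₁c : ∀ a ∈ T₁, cond true (τ a) (ρ a) ∈ T := fun a ha => by simpa using mT₁ a ha
  have mU₀c : ∀ a ∈ U₀, cond false (τ a) (ρ a) ∈ U := fun a ha => by simpa using mU₀ a ha
  have mU₁c : ∀ a ∈ U₁, cond true (τ a) (ρ a) ∈ U := fun a ha => by simpa using mU₁ a ha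
  -- numerics
  have cS := card_eq_parts' hρ hτ hne hsurj S
  have cT := card_eq_parts' hρ hτ hne hsurj T
  have cU := card_eq_parts' hρ hτ hne hsurj U
  have hprod : S.card * T.card * U.card = 8 * (S₀.card * T₀.card * U₀.card) := by
    rw [cS, cT, cU, ← hS, ← hT, ← hU]; ring
  rw [hprod] at hV
  have hn : S₀.card * T₀.card * U₀.card + S₀.card * T₀.card * U₀.card + S₀.card * T₀.card * U₀.card + 1 =
      Fintype.card A := by omega
  -- boxes
  have cs := card_sumset' hρρ hττ hρ hτ h
  have inj := sum_injOn' hρρ hττ hρ hτ h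
  have iB1 := inj true false false mS₁c mT₀c mU₀c
  have iB2 := inj false true false mS₀c mT₁c mU₀c
  have iB3 := inj false false true mS₀c mT₀c mU₁c
  have d₁ := disjoint_sumset₁' hρρ hρτ hτρ hττ hne h false mS₁ mT₀ mU₀c mS₀ mT₁
  have d₂ := disjoint_sumset₂' hρρ hρτ hτρ hττ hne h false mS₀c mT₁ mU₀ mS₀c mT₀ mU₁
  have d₃ := disjoint_sumset₃' hρρ hρτ hτρ hττ hne h false mS₀ mT₀c mU₁ mS₁ mU₀
  obtain ⟨x₁, hx₁⟩ := exists_missed_point d₁ d₃.symm d₂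
    (by rw [cs true false false mS₁c mT₀c mU₀c, cs false true false mS₀c mT₁c mU₀c, cs false false true mS₀c mT₀c mU₁c,
          ← hS, ← hT, ← hU]; exact hn)
  have hcov : ((S₁ ×ˢ T₀ ×ˢ U₀).image (fun p : A × A × A => p.1 + p.2.1 + p.2.2)) ∪
      ((S₀ ×ˢ T₁ ×ˢ U₀).image (fun p : A × A × A => p.1 + p.2.1 + p.2.2)) ∪
      ((S₀ ×ˢ T₀ ×ˢ U₁).image (fun p : A × A × A => p.1 + p.2.1 + p.2.2)) = univ.erase x₁ := by
    ext a
    have ha := congrArg (fun s : Finset A => a ∈ s) hx₁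
    simp only [mem_sdiff, mem_univ, true_and, mem_singleton, eq_iff_iff] at ha
    simp only [mem_erase, mem_univ, and_true]
    tauto
  have hκS1 : S₁ = S₀.image (fun w => κS - w) := hκS
  have hκT1 : T₁ = T₀.image (fun t => κT - t) := hκT
  have hκU1 : U₁ = U₀.image (fun u => κU - u) := hκU
  rw [hκS1] at iB1 d₁ d₃ hcov
  rw [hκT1] at iB2 d₁ d₂ hcov
  rw [hκU1] at iB3 d₂ d₃ hcov
  -- halves and translated sets
  obtain ⟨b, hb⟩ := hhalf (κS - κT)
  obtain ⟨c, hc⟩ := hhalf (κS - κU)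
  set z : A := κS - b - c with hz
  set X : Finset A := T₀.image fun x => x + b with hX
  set Y : Finset A := U₀.image fun y => y + c with hY
  -- the three reduced boxes are translates (by −z) of the three vertex boxes
  have eP : ((S₀ ×ˢ X ×ˢ Y).image fun p : A × A × A => -p.1 + p.2.1 + p.2.2).image (fun w => w + z) =
      ((S₀.image fun w => κS - w) ×ˢ T₀ ×ˢ U₀).image (fun p : A × A × A => p.1 + p.2.1 + p.2.2) := by
    ext v
    simp only [hX, hY, mem_image, mem_product, Prod.exists]
    constructor
    · rintro ⟨v', ⟨w, x', y', ⟨hw, ⟨t, ht, rfl⟩, ⟨u, hu, rfl⟩⟩, rfl⟩, rfl⟩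
      refine ⟨κS - w, t, u, ⟨⟨w, hw, rfl⟩, ht, hu⟩, ?_⟩
      rw [hz]; abel
    · rintro ⟨w', t, u, ⟨⟨w, hw, rfl⟩, ht, hu⟩, rfl⟩
      refine ⟨-w + (t + b) + (u + c), ⟨w, t + b, u + c, ⟨hw, ⟨t, ht, rfl⟩, ⟨u, hu, rfl⟩⟩, rfl⟩, ?_⟩
      rw [hz]; abel
  have eQ : ((S₀ ×ˢ X ×ˢ Y).image fun p : A × A × A => p.1 - p.2.1 + p.2.2).image (fun w => w + z) =
      (S₀ ×ˢ (T₀.image fun t => κT - t) ×ˢ U₀).image (fun p : A × A × A => p.1 + p.2.1 + p.2.2) := by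
    ext v
    simp only [hX, hY, mem_image, mem_product, Prod.exists]
    constructor
    · rintro ⟨v', ⟨w, x', y', ⟨hw, ⟨t, ht, rfl⟩, ⟨u, hu, rfl⟩⟩, rfl⟩, rfl⟩
      refine ⟨w, κT - t, u, ⟨hw, ⟨t, ht, rfl⟩, hu⟩, ?_⟩
      have e : w - (t + b) + (u + c) + z - (w + (κT - t) + u) = (κS - κT) - (b + b) := by rw [hz]; abel
      rw [hb, sub_self, sub_eq_zero] at e
      exact e.symm
    · rintro ⟨w, t', u, ⟨hw, ⟨t, ht, rfl⟩, hu⟩, rfl⟩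
      refine ⟨w - (t + b) + (u + c), ⟨w, t + b, u + c, ⟨hw, ⟨t, ht, rfl⟩, ⟨u, hu, rfl⟩⟩, rfl⟩, ?_⟩
      have e : w - (t + b) + (u + c) + z - (w + (κT - t) + u) = (κS - κT) - (b + b) := by rw [hz]; abel
      rw [hb, sub_self, sub_eq_zero] at e
      exact e
  have eR : ((S₀ ×ˢ X ×ˢ Y).image fun p : A × A × A => p.1 + p.2.1 - p.2.2).image (fun w => w + z) =
      (S₀ ×ˢ T₀ ×ˢ (U₀.image fun u => κU - u)).image (fun p : A × A × A => p.1 + p.2.1 + p.2.2) := by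
    ext v
    simp only [hX, hY, mem_image, mem_product, Prod.exists]
    constructor
    · rintro ⟨v', ⟨w, x', y', ⟨hw, ⟨t, ht, rfl⟩, ⟨u, hu, rfl⟩⟩, rfl⟩, rfl⟩
      refine ⟨w, t, κU - u, ⟨hw, ht, ⟨u, hu, rfl⟩⟩, ?_⟩
      have e : w + (t + b) - (u + c) + z - (w + t + (κU - u)) = (κS - κU) - (c + c) := by rw [hz]; abel
      rw [hc, sub_self, sub_eq_zero] at e
      exact e.symm
    · rintro ⟨w, t, u', ⟨hw, ht, ⟨u, hu, rfl⟩⟩, rfl⟩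
      refine ⟨w + (t + b) - (u + c), ⟨w, t + b, u + c, ⟨hw, ⟨t, ht, rfl⟩, ⟨u, hu, rfl⟩⟩, rfl⟩, ?_⟩
      have e : w + (t + b) - (u + c) + z - (w + t + (κU - u)) = (κS - κU) - (c + c) := by rw [hz]; abel
      rw [hc, sub_self, sub_eq_zero] at e
      exact e
  -- injectivity transfer: a signed translated sum is injective iff the vertex-box sum is
  have injP : Set.InjOn (fun p : A × A × A => -p.1 + p.2.1 + p.2.2) ↑(S₀ ×ˢ X ×ˢ Y) := by
    rintro ⟨w, x', y'⟩ hp ⟨w₂, x₂, y₂⟩ hp' he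
    simp only [hX, hY, coe_product, coe_image, Set.mem_prod, Set.mem_image, mem_coe] at hp hp'
    obtain ⟨hw, ⟨t, ht, rfl⟩, ⟨u, hu, rfl⟩⟩ := hp
    obtain ⟨hw₂, ⟨t₂, ht₂, rfl⟩, ⟨u₂, hu₂, rfl⟩⟩ := hp'
    change -w + (t + b) + (u + c) = -w₂ + (t₂ + b) + (u₂ + c) at he
    have hm : (κS - w, t, u) ∈ (↑((S₀.image fun w => κS - w) ×ˢ T₀ ×ˢ U₀) : Set (A × A × A)) := by
      simp only [coe_product, coe_image, Set.mem_prod, Set.mem_image, mem_coe]; exact ⟨⟨w, hw, rfl⟩, ht, hu⟩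
    have hm₂ : (κS - w₂, t₂, u₂) ∈ (↑((S₀.image fun w => κS - w) ×ˢ T₀ ×ˢ U₀) : Set (A × A × A)) := by
      simp only [coe_product, coe_image, Set.mem_prod, Set.mem_image, mem_coe]; exact ⟨⟨w₂, hw₂, rfl⟩, ht₂, hu₂⟩
    have key := iB1 hm hm₂ (by
      change κS - w + t + u = κS - w₂ + t₂ + u₂
      have e : (-w + (t + b) + (u + c)) + (κS - b - c) = (-w₂ + (t₂ + b) + (u₂ + c)) + (κS - b - c) := by rw [he]
      calc κS - w + t + u = (-w + (t + b) + (u + c)) + (κS - b - c) := by abel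
        _ = (-w₂ + (t₂ + b) + (u₂ + c)) + (κS - b - c) := e
        _ = κS - w₂ + t₂ + u₂ := by abel)
    simp only [Prod.mk.injEq] at key
    obtain ⟨h1, h2, h3⟩ := key
    have hw' : w = w₂ := by
      have := congrArg (fun v => κS - v) h1; simpa using this
    rw [hw', h2, h3]
  have injQ : Set.InjOn (fun p : A × A × A => p.1 - p.2.1 + p.2.2) ↑(S₀ ×ˢ X ×ˢ Y) := by
    rintro ⟨w, x', y'⟩ hp ⟨w₂, x₂, y₂⟩ hp' he
    simp only [hX, hY, coe_product, coe_image, Set.mem_prod, Set.mem_image, mem_coe] at hp hp'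
    obtain ⟨hw, ⟨t, ht, rfl⟩, ⟨u, hu, rfl⟩⟩ := hp
    obtain ⟨hw₂, ⟨t₂, ht₂, rfl⟩, ⟨u₂, hu₂, rfl⟩⟩ := hp'
    change w - (t + b) + (u + c) = w₂ - (t₂ + b) + (u₂ + c) at he
    have hm : (w, κT - t, u) ∈ (↑(S₀ ×ˢ (T₀.image fun t => κT - t) ×ˢ U₀) : Set (A × A × A)) := by
      simp only [coe_product, coe_image, Set.mem_prod, Set.mem_image, mem_coe]; exact ⟨hw, ⟨t, ht, rfl⟩, hu⟩
    have hm₂ : (w₂, κT - t₂, u₂) ∈ (↑(S₀ ×ˢ (T₀.image fun t => κT - t) ×ˢ U₀) : Set (A × A × A)) := by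
      simp only [coe_product, coe_image, Set.mem_prod, Set.mem_image, mem_coe]; exact ⟨hw₂, ⟨t₂, ht₂, rfl⟩, hu₂⟩
    have key := iB2 hm hm₂ (by
      change w + (κT - t) + u = w₂ + (κT - t₂) + u₂
      have e : (w - (t + b) + (u + c)) + (κT + b - c) = (w₂ - (t₂ + b) + (u₂ + c)) + (κT + b - c) := by rw [he]
      calc w + (κT - t) + u = (w - (t + b) + (u + c)) + (κT + b - c) := by abel
        _ = (w₂ - (t₂ + b) + (u₂ + c)) + (κT + b - c) := e
        _ = w₂ + (κT - t₂) + u₂ := by abel)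
    simp only [Prod.mk.injEq] at key
    obtain ⟨h1, h2, h3⟩ := key
    have ht' : t = t₂ := by
      have := congrArg (fun v => κT - v) h2; simpa using this
    rw [h1, ht', h3]
  have injR : Set.InjOn (fun p : A × A × A => p.1 + p.2.1 - p.2.2) ↑(S₀ ×ˢ X ×ˢ Y) := by
    rintro ⟨w, x', y'⟩ hp ⟨w₂, x₂, y₂⟩ hp' he
    simp only [hX, hY, coe_product, coe_image, Set.mem_prod, Set.mem_image, mem_coe] at hp hp'
    obtain ⟨hw, ⟨t, ht, rfl⟩, ⟨u, hu, rfl⟩⟩ := hp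
    obtain ⟨hw₂, ⟨t₂, ht₂, rfl⟩, ⟨u₂, hu₂, rfl⟩⟩ := hp'
    change w + (t + b) - (u + c) = w₂ + (t₂ + b) - (u₂ + c) at he
    have hm : (w, t, κU - u) ∈ (↑(S₀ ×ˢ T₀ ×ˢ (U₀.image fun u => κU - u)) : Set (A × A × A)) := by
      simp only [coe_product, coe_image, Set.mem_prod, Set.mem_image, mem_coe]; exact ⟨hw, ht, ⟨u, hu, rfl⟩⟩
    have hm₂ : (w₂, t₂, κU - u₂) ∈ (↑(S₀ ×ˢ T₀ ×ˢ (U₀.image fun u => κU - u)) : Set (A × A × A)) := by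
      simp only [coe_product, coe_image, Set.mem_prod, Set.mem_image, mem_coe]; exact ⟨hw₂, ht₂, ⟨u₂, hu₂, rfl⟩⟩
    have key := iB3 hm hm₂ (by
      change w + t + (κU - u) = w₂ + t₂ + (κU - u₂)
      have e : (w + (t + b) - (u + c)) + (κU - b + c) = (w₂ + (t₂ + b) - (u₂ + c)) + (κU - b + c) := by rw [he]
      calc w + t + (κU - u) = (w + (t + b) - (u + c)) + (κU - b + c) := by abel
        _ = (w₂ + (t₂ + b) - (u₂ + c)) + (κU - b + c) := e
        _ = w₂ + t₂ + (κU - u₂) := by abel)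
    simp only [Prod.mk.injEq] at key
    obtain ⟨h1, h2, h3⟩ := key
    have hu' : u = u₂ := by
      have := congrArg (fun v => κU - v) h3; simpa using this
    rw [h1, h2, hu']
  refine ⟨S₀, X, Y, x₁ - z, rfl, ?_, ?_, injP, injQ, injR, ?_, ?_, ?_, ?_⟩
  · rw [hX, card_image_of_injective _ (add_left_injective b)]
  · rw [hY, card_image_of_injective _ (add_left_injective c)]
  · refine disjoint_of_disjoint_image_add z ?_
    rw [eP, eQ]; exact d₁
  · refine disjoint_of_disjoint_image_add z ?_
    rw [eP, eR]; exact d₃.symm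
  · refine disjoint_of_disjoint_image_add z ?_
    rw [eQ, eR]; exact d₂
  · ext w
    have key : w + z ∈ ((S₀.image fun w => κS - w) ×ˢ T₀ ×ˢ U₀).image (fun p : A × A × A => p.1 + p.2.1 + p.2.2) ∪
        (S₀ ×ˢ (T₀.image fun t => κT - t) ×ˢ U₀).image (fun p : A × A × A => p.1 + p.2.1 + p.2.2) ∪
        (S₀ ×ˢ T₀ ×ˢ (U₀.image fun u => κU - u)).image (fun p : A × A × A => p.1 + p.2.1 + p.2.2) ↔
        w + z ∈ univ.erase x₁ := by rw [hcov]
    rw [← eP, ← eQ, ← eR] at key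
    simp only [mem_union, (add_left_injective z).mem_finset_image, mem_erase, mem_univ, and_true] at key
    simp only [mem_union, mem_erase, mem_univ, and_true]
    rw [key]
    constructor
    · intro hw hc'; exact hw (by rw [hc']; abel)
    · intro hw hc'; exact hw (by rw [← hc']; abel)

end DihedralLike

end Summit.MatrixMultiplication.OmegaCensus
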